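import Summits.CriticalPhenomena.PercolationContinuityZ3.Theorems.PercNearOneGluingNoHeavyLowerTailKnQuestion8CoefficientwiseZoneFlip
import HarnessLib

/-!
# The blue-island flip: every cluster-pair class is outweighed by its merged class

Support file (`--supports stmt-CriticalPhenomena-4575`, closed), prover `prim-cplus-coupling` (gen 28).  No definitions, no notations, no named
facts, no sorries; standard axioms.  Memo `prim-cplus-coupling/A5-COUPLING-gen28.md` §2.2 (THEOREM P).

Setting (prim-lf-2's `Coefficientwise` files): finite multigraph `ends : ι → Sym2 V`, colourings `s : Finset ι` (red; `sᶜ` blue), `C_x(s) = openCluster (ends '' s) x`,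
`K = C_x(s)` the red and `L = C_x(sᶜ)` the blue cluster of `x`.  THE BLUE-ISLAND FLIP recolours every edge meeting the 'blue island' `L ∖ K`:
`Φ(s) = s ∆ M` where `M` is the set of edges with an end in `L ∖ K`.  This file proves, for any `M` with that description
(`hM : i ∈ M ↔ ∃ v, (v ∈ L ∧ v ∉ K) ∧ v ∈ ends i`):
* `Coefficientwise.islandFlip_subset` / `islandFlip_supset` — `C_x(s ∆ M) = K ∪ L` (the new red cluster is the union of the old two);
* `Coefficientwise.islandFlip_compl_subset` — `C_x((s ∆ M)ᶜ) ⊆ K ∩ L` (the new blue cluster lies in the old bichromatic core);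
* `Coefficientwise.islandFlip_mem` — the two-sided disconnection `{z ∉ C_x(s)} ∩ {z ∉ C_x(sᶜ)}` is preserved;
* `Coefficientwise.card_pairClass_le_card_merged` — **THEOREM P**: for all vertex sets `K₀, L₀`,
  `#{s ∈ S : C_x(s) = K₀, C_x(sᶜ) = L₀} ≤ #{s ∈ S : K₀ ∪ L₀ ⊆ C_x(s), C_x(sᶜ) ⊆ K₀ ∩ L₀}`, `S = {z ∉ C_x(s)} ∩ {z ∉ C_x(sᶜ)}`
  (`Φ` is injective on the class, since `M` is determined by `(K₀, L₀)`).
THEOREM P is the principal × mirror-principal case of conjecture SUPER (memo §1; file …CoefficientwiseMirror): for the twisted up-sets `𝒰 = ↑(K₀,L₀)` and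
`𝒱 = ↑(L₀,K₀)` the orbits on which `𝒰, 𝒱` disagree form exactly the class of `(K₀,L₀)` and those on which they agree form exactly the merged class.  The same map
sends the 'disagreeing' configurations of ANY two twisted up-sets into the 'agreeing' ones (it is the canonical dominating map of the first rung CW-PA), but it is not
injective across classes (star `K_{1,3}` with an isolated conditioning vertex), which is why SUPER/CW-PA stay open.
[cite: KozmaNitzan2024, Questions 8–9 (§5.5 p. 36) (context: the Question-8 pocket covariance programme)]
-/

namespace Summit.CriticalPhenomena.PercolationContinuityZ3.Theorems

open Finset Literature.Probability.Percolation

namespace Coefficientwise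

variable {ι V : Type*} [Fintype ι] [DecidableEq ι]
variable (ends : ι → Sym2 V) (x : V)

/-- Red edges at the old red cluster are not flipped, so the old red cluster survives: `C_x(s) ⊆ C_x(s ∆ M)`. [this work] -/
theorem islandFlip_red_subset (s M : Finset ι)
    (hM : ∀ i, i ∈ M ↔ ∃ v, (v ∈ openCluster (ends '' (↑(sᶜ) : Set ι)) x ∧ v ∉ openCluster (ends '' (↑s : Set ι)) x) ∧ v ∈ ends i) :
    openCluster (ends '' (↑s : Set ι)) x ⊆ openCluster (ends '' (↑(symmDiff s M) : Set ι)) x := by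
  set K : Set V := openCluster (ends '' (↑s : Set ι)) x with hK
  have h : ∀ u ∈ K, ∀ w, (openGraph (ends '' (↑s : Set ι))).Adj u w →
      (openGraph (ends '' (↑(symmDiff s M) : Set ι))).Adj u w ∧ w ∈ K := by
    intro u hu w hadj
    have hadj0 := hadj
    rw [openGraph_image_adj] at hadj
    obtain ⟨⟨i, his, hi⟩, hne⟩ := hadj
    have hwK : w ∈ K := SimpleGraph.Reachable.trans hu hadj0.reachable
    have hiM : i ∉ M := by
      intro hiM
      obtain ⟨v, ⟨_, hvK⟩, hvi⟩ := (hM i).mp hiM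
      rw [hi, Sym2.mem_iff] at hvi
      rcases hvi with rfl | rfl
      · exact hvK hu
      · exact hvK hwK
    refine ⟨?_, hwK⟩
    rw [openGraph_image_adj]
    exact ⟨⟨i, Finset.mem_symmDiff.mpr (Or.inl ⟨his, hiM⟩), hi⟩, hne⟩
  intro y hy
  obtain ⟨p⟩ := hy
  exact ((reachable_transfer K h p) (mem_openCluster_self _ x)).1

/-- The old blue cluster is swallowed: `C_x(sᶜ) ⊆ C_x(s ∆ M)` (along a blue walk from `x`, a vertex of the old red cluster is red-reachable by the previous
lemma, and a vertex of the blue island is entered through a flipped, now red, edge). [this work] -/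
theorem islandFlip_blue_subset (s M : Finset ι)
    (hM : ∀ i, i ∈ M ↔ ∃ v, (v ∈ openCluster (ends '' (↑(sᶜ) : Set ι)) x ∧ v ∉ openCluster (ends '' (↑s : Set ι)) x) ∧ v ∈ ends i) :
    openCluster (ends '' (↑(sᶜ) : Set ι)) x ⊆ openCluster (ends '' (↑(symmDiff s M) : Set ι)) x := by
  set K : Set V := openCluster (ends '' (↑s : Set ι)) x with hK
  set L : Set V := openCluster (ends '' (↑(sᶜ) : Set ι)) x with hL
  set K' : Set V := openCluster (ends '' (↑(symmDiff s M) : Set ι)) x with hK'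
  have hKK' : K ⊆ K' := islandFlip_red_subset ends x s M hM
  -- invariant set: vertices of `L` that are already in `K'`
  have h : ∀ u ∈ (K' ∩ L), ∀ w, (openGraph (ends '' (↑(sᶜ) : Set ι))).Adj u w →
      (⊤ : SimpleGraph V).Adj u w ∧ w ∈ (K' ∩ L) := by
    intro u hu w hadj
    have hadj0 := hadj
    rw [openGraph_image_adj] at hadj
    obtain ⟨⟨i, hisc, hi⟩, hne⟩ := hadj
    have hwL : w ∈ L := SimpleGraph.Reachable.trans hu.2 hadj0.reachable
    refine ⟨(SimpleGraph.top_adj u w).mpr hne, ?_, hwL⟩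
    by_cases hwK : w ∈ K
    · exact hKK' hwK
    · -- the blue edge `i` meets the island at `w`, so it is flipped to red
      have hiM : i ∈ M := (hM i).mpr ⟨w, ⟨hwL, hwK⟩, by rw [hi]; exact Sym2.mem_mk_right u w⟩
      have his : i ∉ s := Finset.mem_compl.mp hisc
      have hiP : i ∈ symmDiff s M := Finset.mem_symmDiff.mpr (Or.inr ⟨hiM, his⟩)
      have hadj' : (openGraph (ends '' (↑(symmDiff s M) : Set ι))).Adj u w := by
        rw [openGraph_image_adj]; exact ⟨⟨i, hiP, hi⟩, hne⟩
      exact SimpleGraph.Reachable.trans hu.1 hadj'.reachable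
  intro y hy
  obtain ⟨p⟩ := hy
  have hx : x ∈ K' ∩ L := ⟨mem_openCluster_self _ x, mem_openCluster_self _ x⟩
  exact ((reachable_transfer (K' ∩ L) h p) hx).2.1

/-- The new red cluster does not leave `K ∪ L`: `C_x(s ∆ M) ⊆ C_x(s) ∪ C_x(sᶜ)`. [this work] -/
theorem islandFlip_subset (s M : Finset ι)
    (hM : ∀ i, i ∈ M ↔ ∃ v, (v ∈ openCluster (ends '' (↑(sᶜ) : Set ι)) x ∧ v ∉ openCluster (ends '' (↑s : Set ι)) x) ∧ v ∈ ends i) :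
    openCluster (ends '' (↑(symmDiff s M) : Set ι)) x ⊆ openCluster (ends '' (↑s : Set ι)) x ∪ openCluster (ends '' (↑(sᶜ) : Set ι)) x := by
  set K : Set V := openCluster (ends '' (↑s : Set ι)) x with hK
  set L : Set V := openCluster (ends '' (↑(sᶜ) : Set ι)) x with hL
  have h : ∀ u ∈ (K ∪ L), ∀ w, (openGraph (ends '' (↑(symmDiff s M) : Set ι))).Adj u w →
      (⊤ : SimpleGraph V).Adj u w ∧ w ∈ (K ∪ L) := by
    intro u hu w hadj
    rw [openGraph_image_adj] at hadj
    obtain ⟨⟨i, hiP, hi⟩, hne⟩ := hadj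
    refine ⟨(SimpleGraph.top_adj u w).mpr hne, ?_⟩
    have hui : u ∈ ends i := by rw [hi]; exact Sym2.mem_mk_left u w
    have hwi : w ∈ ends i := by rw [hi]; exact Sym2.mem_mk_right u w
    rcases Finset.mem_symmDiff.mp hiP with ⟨his, hiM⟩ | ⟨hiM, his⟩
    · -- unflipped red edge: `u` is not on the island, so `u ∈ K` and then `w ∈ K`
      have huK : u ∈ K := by
        rcases hu with huK | huL
        · exact huK
        · by_contra huK
          exact hiM ((hM i).mpr ⟨u, ⟨huL, huK⟩, hui⟩)
      exact Or.inl (mem_openCluster_of_mem_ends ends s x his huK hui hwi)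
    · -- flipped edge: it was blue and has an end `v` on the island (`v ∈ L`); then both ends are in `L`
      obtain ⟨v, ⟨hvL, _⟩, hvi⟩ := (hM i).mp hiM
      have hisc : i ∈ sᶜ := Finset.mem_compl.mpr his
      right
      rw [hi, Sym2.mem_iff] at hvi
      rcases hvi with rfl | rfl
      · exact mem_openCluster_of_mem_ends ends sᶜ x hisc hvL hui hwi
      · exact hvL
  intro y hy
  obtain ⟨p⟩ := hy
  have hx : x ∈ K ∪ L := Or.inl (mem_openCluster_self _ x)
  exact ((reachable_transfer (K ∪ L) h p) hx).2

/-- `C_x(s) ∪ C_x(sᶜ) ⊆ C_x(s ∆ M)`. [this work] -/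
theorem islandFlip_supset (s M : Finset ι)
    (hM : ∀ i, i ∈ M ↔ ∃ v, (v ∈ openCluster (ends '' (↑(sᶜ) : Set ι)) x ∧ v ∉ openCluster (ends '' (↑s : Set ι)) x) ∧ v ∈ ends i) :
    openCluster (ends '' (↑s : Set ι)) x ∪ openCluster (ends '' (↑(sᶜ) : Set ι)) x ⊆ openCluster (ends '' (↑(symmDiff s M) : Set ι)) x :=
  Set.union_subset (islandFlip_red_subset ends x s M hM) (islandFlip_blue_subset ends x s M hM)

/-- The new blue cluster lies in the old bichromatic core: `C_x((s ∆ M)ᶜ) ⊆ C_x(s) ∩ C_x(sᶜ)`. [this work] -/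
theorem islandFlip_compl_subset (s M : Finset ι)
    (hM : ∀ i, i ∈ M ↔ ∃ v, (v ∈ openCluster (ends '' (↑(sᶜ) : Set ι)) x ∧ v ∉ openCluster (ends '' (↑s : Set ι)) x) ∧ v ∈ ends i) :
    openCluster (ends '' (↑((symmDiff s M)ᶜ) : Set ι)) x ⊆ openCluster (ends '' (↑s : Set ι)) x ∩ openCluster (ends '' (↑(sᶜ) : Set ι)) x := by
  set K : Set V := openCluster (ends '' (↑s : Set ι)) x with hK
  set L : Set V := openCluster (ends '' (↑(sᶜ) : Set ι)) x with hL
  have h : ∀ u ∈ (K ∩ L), ∀ w, (openGraph (ends '' (↑((symmDiff s M)ᶜ) : Set ι))).Adj u w →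
      (⊤ : SimpleGraph V).Adj u w ∧ w ∈ (K ∩ L) := by
    intro u hu w hadj
    rw [openGraph_image_adj] at hadj
    obtain ⟨⟨i, hiPc, hi⟩, hne⟩ := hadj
    refine ⟨(SimpleGraph.top_adj u w).mpr hne, ?_⟩
    have hui : u ∈ ends i := by rw [hi]; exact Sym2.mem_mk_left u w
    have hwi : w ∈ ends i := by rw [hi]; exact Sym2.mem_mk_right u w
    have hiPc' : i ∉ symmDiff s M := Finset.mem_compl.mp hiPc
    rw [Finset.mem_symmDiff] at hiPc'
    by_cases his : i ∈ s
    · -- red and flipped... impossible: then `i ∈ M`, i.e. `i` meets the island, but both ends are in `K`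
      have hiM : i ∈ M := by by_contra hiM; exact hiPc' (Or.inl ⟨his, hiM⟩)
      have hwK : w ∈ K := mem_openCluster_of_mem_ends ends s x his hu.1 hui hwi
      obtain ⟨v, ⟨_, hvK⟩, hvi⟩ := (hM i).mp hiM
      rw [hi, Sym2.mem_iff] at hvi
      rcases hvi with rfl | rfl
      · exact absurd hu.1 hvK
      · exact absurd hwK hvK
    · -- blue and not flipped: `w ∈ L`, and `w` is not on the island, so `w ∈ K`
      have hiM : i ∉ M := by intro hiM; exact hiPc' (Or.inr ⟨hiM, his⟩)
      have hisc : i ∈ sᶜ := Finset.mem_compl.mpr his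
      have hwL : w ∈ L := mem_openCluster_of_mem_ends ends sᶜ x hisc hu.2 hui hwi
      have hwK : w ∈ K := by
        by_contra hwK
        exact hiM ((hM i).mpr ⟨w, ⟨hwL, hwK⟩, hwi⟩)
      exact ⟨hwK, hwL⟩
  intro y hy
  obtain ⟨p⟩ := hy
  have hx : x ∈ K ∩ L := ⟨mem_openCluster_self _ x, mem_openCluster_self _ x⟩
  exact ((reachable_transfer (K ∩ L) h p) hx).2

/-- The blue-island flip preserves the two-sided disconnection `{z ∉ C_x(s)} ∩ {z ∉ C_x(sᶜ)}`. [this work] -/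
theorem islandFlip_mem (z : V) (s M : Finset ι)
    (hM : ∀ i, i ∈ M ↔ ∃ v, (v ∈ openCluster (ends '' (↑(sᶜ) : Set ι)) x ∧ v ∉ openCluster (ends '' (↑s : Set ι)) x) ∧ v ∈ ends i)
    (h1 : z ∉ openCluster (ends '' (↑s : Set ι)) x) (h2 : z ∉ openCluster (ends '' (↑(sᶜ) : Set ι)) x) :
    z ∉ openCluster (ends '' (↑(symmDiff s M) : Set ι)) x ∧ z ∉ openCluster (ends '' (↑((symmDiff s M)ᶜ) : Set ι)) x := by
  constructor
  · intro hz
    rcases islandFlip_subset ends x s M hM hz with h | h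
    · exact h1 h
    · exact h2 h
  · intro hz
    exact h1 (islandFlip_compl_subset ends x s M hM hz).1

open Classical in
/-- **THEOREM P (every cluster-pair class is outweighed by its merged class).**  For a finite multigraph `ends : ι → Sym2 V`, vertices `x, z` and
vertex sets `K₀, L₀`, on `S = {s | z ∉ C_x(s), z ∉ C_x(sᶜ)}`:
  `#{s ∈ S : C_x(s) = K₀ ∧ C_x(sᶜ) = L₀} ≤ #{s ∈ S : K₀ ∪ L₀ ⊆ C_x(s) ∧ C_x(sᶜ) ⊆ K₀ ∩ L₀}`.
Proof: the blue-island flip `s ↦ s ∆ M`, `M` = the edges meeting `L₀ ∖ K₀`, maps the class into the merged class (`islandFlip_supset`,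
`islandFlip_compl_subset`, `islandFlip_mem`) and is injective there (`M` is the same for the whole class). [this work] -/
theorem card_pairClass_le_card_merged (z : V) (K₀ L₀ : Set V) :
    (univ.filter (fun s : Finset ι => (z ∉ openCluster (ends '' (↑s : Set ι)) x ∧ z ∉ openCluster (ends '' (↑(sᶜ) : Set ι)) x) ∧
        (openCluster (ends '' (↑s : Set ι)) x = K₀ ∧ openCluster (ends '' (↑(sᶜ) : Set ι)) x = L₀))).card ≤
      (univ.filter (fun s : Finset ι => (z ∉ openCluster (ends '' (↑s : Set ι)) x ∧ z ∉ openCluster (ends '' (↑(sᶜ) : Set ι)) x) ∧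
        (K₀ ∪ L₀ ⊆ openCluster (ends '' (↑s : Set ι)) x ∧ openCluster (ends '' (↑(sᶜ) : Set ι)) x ⊆ K₀ ∩ L₀))).card := by
  set M : Finset ι := univ.filter (fun i : ι => ∃ v, (v ∈ L₀ ∧ v ∉ K₀) ∧ v ∈ ends i) with hMdef
  set A := univ.filter (fun s : Finset ι => (z ∉ openCluster (ends '' (↑s : Set ι)) x ∧ z ∉ openCluster (ends '' (↑(sᶜ) : Set ι)) x) ∧
        (openCluster (ends '' (↑s : Set ι)) x = K₀ ∧ openCluster (ends '' (↑(sᶜ) : Set ι)) x = L₀)) with hA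
  set B := univ.filter (fun s : Finset ι => (z ∉ openCluster (ends '' (↑s : Set ι)) x ∧ z ∉ openCluster (ends '' (↑(sᶜ) : Set ι)) x) ∧
        (K₀ ∪ L₀ ⊆ openCluster (ends '' (↑s : Set ι)) x ∧ openCluster (ends '' (↑(sᶜ) : Set ι)) x ⊆ K₀ ∩ L₀)) with hB
  have hMs : ∀ s : Finset ι, openCluster (ends '' (↑s : Set ι)) x = K₀ → openCluster (ends '' (↑(sᶜ) : Set ι)) x = L₀ →
      ∀ i, i ∈ M ↔ ∃ v, (v ∈ openCluster (ends '' (↑(sᶜ) : Set ι)) x ∧ v ∉ openCluster (ends '' (↑s : Set ι)) x) ∧ v ∈ ends i := by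
    intro s hK hL i
    rw [hK, hL]
    simp [hMdef]
  refine Finset.card_le_card_of_injOn (fun s => symmDiff s M) ?_ ?_
  · intro s hs
    rw [Finset.mem_coe, hA, Finset.mem_filter] at hs
    obtain ⟨_, ⟨hz1, hz2⟩, hK, hL⟩ := hs
    have hM := hMs s hK hL
    rw [Finset.mem_coe, hB, Finset.mem_filter]
    refine ⟨Finset.mem_univ _, islandFlip_mem ends x z s M hM hz1 hz2, ?_, ?_⟩
    · have := islandFlip_supset ends x s M hM
      rw [hK, hL] at this
      exact this
    · have := islandFlip_compl_subset ends x s M hM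
      rw [hK, hL] at this
      exact this
  · intro s₁ _ s₂ _ h
    have : symmDiff (symmDiff s₁ M) M = symmDiff (symmDiff s₂ M) M := by
      simp only at h
      rw [h]
    rwa [symmDiff_symmDiff_cancel_right, symmDiff_symmDiff_cancel_right] at this

end Coefficientwise

end Summit.CriticalPhenomena.PercolationContinuityZ3.Theorems
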